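import Mathlib.AlgebraicGeometry.Morphisms.UniversallyClosed
import Mathlib.Topology.Separation.Basic
import HarnessLib

/-!
# A closed morphism sends the generic point of `cl{η′}` to the generic point of its image

Topic: `Literature/AlgebraicGeometry/Resolution`. Bookkeeping for the termination argument
of Cossart–Piltant, J. Algebra 320 (2008), proof of Prop. 4.4, p. 10 ("Let `C_1(i), …, C_{n(i)}(i)`
be all one dimensional irreducible components of `Σ(i)` … `n(i+1) ≤ n(i)` … Working above the
generic point `η(i)`"): when a curve `C′ = cl{η′}` of the new locus maps ONTO a curve
`C = cl{η}` under the (closed) blowing-up morphism, its generic point maps to the generic point,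
`π η′ = η` — so the colength comparison of `NearPointColengthDropScheme.lean` applies at
`x′ = η′`. PROVED for any universally closed morphism of schemes (closed continuous map of
`T₀` spaces: `π(cl{η′}) = cl{π η′}`).

* `Scheme.Hom.image_closure_singleton` — `π(cl{η′}) = cl{π η′}` for `π` universally closed;
* `Scheme.Hom.apply_eq_of_image_closure_eq_closure` — **if `π(cl{η′}) = cl{η}` then
  `π η′ = η`.**

## Sources

* V. Cossart, O. Piltant, J. Algebra 320 (2008) 1051–1082, proof of Prop. 4.4, p. 10.
  [CossartPiltant2008]
-/

noncomputable section

open CategoryTheory AlgebraicGeometry TopologicalSpace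

namespace Literature.AlgebraicGeometry.Resolution

universe u

variable {X Y : Scheme.{u}} (π : X ⟶ Y) [UniversallyClosed π]

/-- A universally closed morphism maps the closure of a point onto the closure of its image.
[folklore] -/
theorem Scheme.Hom.image_closure_singleton (η' : X) :
    π.base '' closure {η'} = closure {π η'} := by
  rw [← π.isClosedMap.closure_image_eq_of_continuous π.base.hom.continuous, Set.image_singleton]

/-- **If `π(cl{η′}) = cl{η}` then `π η′ = η`** (generic points are unique in the `T₀` space
`Y`). [cite: CossartPiltant2008, proof of Prop. 4.4] -/
theorem Scheme.Hom.apply_eq_of_image_closure_eq_closure {η' : X} {η : Y}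
    (h : π.base '' closure {η'} = closure {η}) : π η' = η := by
  rw [Scheme.Hom.image_closure_singleton π η'] at h
  have h1 : π η' ⤳ η := by
    rw [specializes_iff_mem_closure, h]
    exact subset_closure (Set.mem_singleton η)
  have h2 : η ⤳ π η' := by
    rw [specializes_iff_mem_closure, ← h]
    exact subset_closure (Set.mem_singleton _)
  exact (h1.antisymm h2).eq

end Literature.AlgebraicGeometry.Resolution

end
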